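import Literature.NumberTheory.Transcendental.CurvePeriodsGmBakerProofs
import Literature.NumberTheory.Transcendental.CurvePeriodsPuncturedLineProofs
import Literature.NumberTheory.Transcendental.CurvePeriodsStokesProofs

/-!
# KontsevichZagierPeriods — kz1p (R1)–(R5) derivations, part 4: logarithm bookkeeping and lattice relations

Cell pub-kz1p, seat b2b-kz1p-2, gen 12 (kz1p v1.3; PROCEDURE.md §4d; LEAN-IN-TREE rule).  [cite: HuberWustholz2022, §13.1 (p. 120)];
no named facts, no `sorry`.

* the principal-value product rule `Log (x y) = Log x + Log y + c·2πi`, `c ∈ {−1, 0, 1}` decided by the signs of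
  `im x, im y, im (xy), re (xy)` (`log_mul_of_*`; the root-of-unity logarithms `log_lit_*` are in part 5);
* `span_latticeRelation_int` / `_real` — an integer relation `Σ k_j M_j = 0` among logarithms of algebraic numbers
  gives the elementary relation `Σ k_j [ℓ(M_j)] ∼ 0` ((R4) along `z ↦ z^k`, (R5)); real version from a multiplicative
  identity of positive reals.
-/

noncomputable section

open scoped BigOperators Real
open MvPolynomial Set Complex
open Literature.NumberTheory.Transcendental
open Literature.NumberTheory.Transcendental.CurvePeriods

namespace Summit.KontsevichZagierPeriods.KzOnePeriods.G0Derivation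

local notation3 "InSpanRel " c:arg => ∃ (k : ℕ) (ρ : Fin k → (PeriodSymbol →₀ ℂ))
  (a : Fin k → ℂ), (∀ l, IsElementaryRelation (ρ l)) ∧ (∀ l, IsAlgebraic ℚ (a l)) ∧
    c = ∑ l, a l • ρ l

local notation3 (prettyPrint := false) "𝔾m" => (⟨2, 1, ![X 0 * X 1 - 1]⟩ : CurveData)

local notation3 "logSym " E:arg => (⟨⟨2, 1, ![X 0 * X 1 - 1]⟩, isSmoothAffineCurve_mulGroup,
  ![X 1, 0], hasAlgCoeffs_ydx, E⟩ : PeriodSymbol)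

/-! ### Principal logarithms of products (exact bookkeeping of `2πi`-multiples)

`Log(xy) = Log x + Log y + 2πi k` with `k ∈ {−1, 0, 1}` decided by the signs of
`im x, im y, im(xy), re(xy)` — the sign conditions are polynomial (in)equalities in the real
coordinates, so kz1p's lattice relations `Σ k_j Log w_j = 2πi N` are certified by `norm_num`
over `ℚ`, `ℚ(i)` and by `√d`-facts over quadratic fields. -/

section Logarithms

/-- `Log(xy) = Log x + Log y + 2πik` for the integer `k` with `Arg(xy) = Arg x + Arg y + 2πk`.
[folklore] -/
theorem log_mul_eq_add_log_add_int {x y : ℂ} (hx : x ≠ 0) (hy : y ≠ 0) (k : ℤ)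
    (hk : arg (x * y) = arg x + arg y + 2 * π * k) :
    log (x * y) = log x + log y + k * (2 * π * I) := by
  refine Complex.ext ?_ ?_
  · simp only [log_re, norm_mul, add_re, mul_re, intCast_re, intCast_im, mul_im, I_re, I_im,
      ofReal_re, ofReal_im, re_ofNat, im_ofNat]
    rw [Real.log_mul (norm_ne_zero_iff.2 hx) (norm_ne_zero_iff.2 hy)]
    ring
  · simp only [log_im, add_im, mul_im, intCast_re, intCast_im, mul_re, I_re, I_im, ofReal_re,
      ofReal_im, re_ofNat, im_ofNat, hk]
    ring

/-- The integer in `Arg(xy) = Arg x + Arg y + 2πk` exists and lies in `{−1, 0, 1}`. [folklore] -/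
theorem exists_int_arg_mul {x y : ℂ} (hx : x ≠ 0) (hy : y ≠ 0) :
    ∃ k : ℤ, arg (x * y) = arg x + arg y + 2 * π * k ∧ -1 ≤ k ∧ k ≤ 1 := by
  obtain ⟨k, hk⟩ := Real.Angle.angle_eq_iff_two_pi_dvd_sub.1
    ((arg_mul_coe_angle hx hy).trans (Real.Angle.coe_add _ _).symm)
  refine ⟨k, by linarith, ?_, ?_⟩
  · have h1 := neg_pi_lt_arg (x * y)
    have h2 := arg_le_pi x
    have h3 := arg_le_pi y
    have h4 := arg_le_pi (x * y)
    by_contra h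
    have hk' : (k : ℝ) ≤ -2 := by exact_mod_cast (show k ≤ -2 by omega)
    nlinarith [Real.pi_pos]
  · have h1 := neg_pi_lt_arg x
    have h2 := neg_pi_lt_arg y
    have h4 := arg_le_pi (x * y)
    by_contra h
    have hk' : (2 : ℝ) ≤ k := by exact_mod_cast (show 2 ≤ k by omega)
    nlinarith [Real.pi_pos]

/-- `Log(xy) = Log x + Log y` if `im x < 0 ≤ im y`. [folklore] -/
theorem log_mul_of_im_neg_of_im_nonneg {x y : ℂ} (hy : y ≠ 0) (hx' : x.im < 0) (hy' : 0 ≤ y.im) :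
    log (x * y) = log x + log y := by
  have hx : x ≠ 0 := fun h => by rw [h] at hx'; simp at hx'
  obtain ⟨k, hk, hk1, hk2⟩ := exists_int_arg_mul hx hy
  have hax := arg_neg_iff.2 hx'
  have hay := arg_nonneg_iff.2 hy'
  have h1 := neg_pi_lt_arg x; have h2 := arg_le_pi y
  have h3 := neg_pi_lt_arg (x * y); have h4 := arg_le_pi (x * y)
  have hk0 : k = 0 := by
    rcases (show k = -1 ∨ k = 0 ∨ k = 1 by omega) with h | h | h
    · exfalso; rw [h] at hk; push_cast at hk; nlinarith [Real.pi_pos]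
    · exact h
    · exfalso; rw [h] at hk; push_cast at hk; nlinarith [Real.pi_pos]
  rw [log_mul_eq_add_log_add_int hx hy k hk, hk0]; simp

/-- `Log(xy) = Log x + Log y` if `im y < 0 ≤ im x`. [folklore] -/
theorem log_mul_of_im_nonneg_of_im_neg {x y : ℂ} (hx : x ≠ 0) (hx' : 0 ≤ x.im) (hy' : y.im < 0) :
    log (x * y) = log x + log y := by
  rw [mul_comm, log_mul_of_im_neg_of_im_nonneg hx hy' hx', add_comm]

/-- `Log(xy) = Log x + Log y` if `x` is a positive real. [folklore] -/
theorem log_mul_of_pos_real {x y : ℂ} (hy : y ≠ 0) (hx' : 0 < x.re) (hx'' : x.im = 0) :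
    log (x * y) = log x + log y := by
  have hx : x ≠ 0 := fun h => by rw [h] at hx'; simp at hx'
  obtain ⟨k, hk, hk1, hk2⟩ := exists_int_arg_mul hx hy
  have hax := arg_eq_zero_iff.2 ⟨hx'.le, hx''⟩
  have h1 := neg_pi_lt_arg y; have h2 := arg_le_pi y
  have h3 := neg_pi_lt_arg (x * y); have h4 := arg_le_pi (x * y)
  have hk0 : k = 0 := by
    rcases (show k = -1 ∨ k = 0 ∨ k = 1 by omega) with h | h | h
    · exfalso; rw [h, hax] at hk; push_cast at hk; nlinarith [Real.pi_pos]
    · exact h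
    · exfalso; rw [h, hax] at hk; push_cast at hk; nlinarith [Real.pi_pos]
  rw [log_mul_eq_add_log_add_int hx hy k hk, hk0]; simp

/-- `Log(xy) = Log x + Log y` if `y` is a positive real. [folklore] -/
theorem log_mul_of_pos_real' {x y : ℂ} (hx : x ≠ 0) (hy' : 0 < y.re) (hy'' : y.im = 0) :
    log (x * y) = log x + log y := by
  rw [mul_comm, log_mul_of_pos_real hx hy' hy'', add_comm]

/-- `Log(xy) = Log x + Log y` if `im x, im y ≥ 0` and `im(xy) > 0`. [folklore] -/
theorem log_mul_of_im_nonneg_of_im_pos {x y : ℂ} (hx' : 0 ≤ x.im) (hy' : 0 ≤ y.im)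
    (hxy : 0 < (x * y).im) : log (x * y) = log x + log y := by
  have hx : x ≠ 0 := fun h => by rw [h] at hxy; simp at hxy
  have hy : y ≠ 0 := fun h => by rw [h] at hxy; simp at hxy
  obtain ⟨k, hk, hk1, hk2⟩ := exists_int_arg_mul hx hy
  have hax := arg_nonneg_iff.2 hx'; have hay := arg_nonneg_iff.2 hy'
  have haxy := arg_nonneg_iff.2 hxy.le
  have haxy' : arg (x * y) ≠ 0 := fun h => by
    have := (arg_eq_zero_iff.1 h).2; rw [this] at hxy; exact lt_irrefl _ hxy
  have h1 := arg_le_pi x; have h2 := arg_le_pi y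
  have h3 := neg_pi_lt_arg (x * y); have h4 := arg_le_pi (x * y)
  have hk0 : k = 0 := by
    rcases (show k = -1 ∨ k = 0 ∨ k = 1 by omega) with h | h | h
    · exfalso; rw [h] at hk; push_cast at hk
      have : arg (x * y) ≤ 0 := by nlinarith [Real.pi_pos]
      exact haxy' (le_antisymm this haxy)
    · exact h
    · exfalso; rw [h] at hk; push_cast at hk; nlinarith [Real.pi_pos]
  rw [log_mul_eq_add_log_add_int hx hy k hk, hk0]; simp

/-- `Log(xy) = Log x + Log y` if `im x, im y ≥ 0` and `xy` is a negative real. [folklore] -/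
theorem log_mul_of_im_nonneg_of_neg_real {x y : ℂ} (hx' : 0 ≤ x.im) (hy' : 0 ≤ y.im)
    (hxy : (x * y).re < 0) (hxy' : (x * y).im = 0) : log (x * y) = log x + log y := by
  have hx : x ≠ 0 := fun h => by rw [h] at hxy; simp at hxy
  have hy : y ≠ 0 := fun h => by rw [h] at hxy; simp at hxy
  obtain ⟨k, hk, hk1, hk2⟩ := exists_int_arg_mul hx hy
  have hax := arg_nonneg_iff.2 hx'; have hay := arg_nonneg_iff.2 hy'
  have haxy := arg_eq_pi_iff.2 ⟨hxy, hxy'⟩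
  have h1 := arg_le_pi x; have h2 := arg_le_pi y
  have hk0 : k = 0 := by
    rcases (show k = -1 ∨ k = 0 ∨ k = 1 by omega) with h | h | h
    · exfalso; rw [h, haxy] at hk; push_cast at hk; nlinarith [Real.pi_pos]
    · exact h
    · exfalso; rw [h, haxy] at hk; push_cast at hk; nlinarith [Real.pi_pos]
  rw [log_mul_eq_add_log_add_int hx hy k hk, hk0]; simp

/-- `Log(xy) = Log x + Log y` if `im x, im y < 0` and `im(xy) < 0`. [folklore] -/
theorem log_mul_of_im_neg_of_im_neg {x y : ℂ} (hx' : x.im < 0) (hy' : y.im < 0)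
    (hxy : (x * y).im < 0) : log (x * y) = log x + log y := by
  have hx : x ≠ 0 := fun h => by rw [h] at hx'; simp at hx'
  have hy : y ≠ 0 := fun h => by rw [h] at hy'; simp at hy'
  obtain ⟨k, hk, hk1, hk2⟩ := exists_int_arg_mul hx hy
  have hax := arg_neg_iff.2 hx'; have hay := arg_neg_iff.2 hy'
  have haxy := arg_neg_iff.2 hxy
  have h1 := neg_pi_lt_arg x; have h2 := neg_pi_lt_arg y
  have h3 := neg_pi_lt_arg (x * y)
  have hk0 : k = 0 := by
    rcases (show k = -1 ∨ k = 0 ∨ k = 1 by omega) with h | h | h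
    · exfalso; rw [h] at hk; push_cast at hk; nlinarith [Real.pi_pos]
    · exact h
    · exfalso; rw [h] at hk; push_cast at hk; nlinarith [Real.pi_pos]
  rw [log_mul_eq_add_log_add_int hx hy k hk, hk0]; simp

/-- `Log(xy) = Log x + Log y − 2πi` if `im x, im y ≥ 0` and `im(xy) < 0`. [folklore] -/
theorem log_mul_of_im_nonneg_of_im_neg' {x y : ℂ} (hx' : 0 ≤ x.im) (hy' : 0 ≤ y.im)
    (hxy : (x * y).im < 0) : log (x * y) = log x + log y - 2 * π * I := by
  have hx : x ≠ 0 := fun h => by rw [h] at hxy; simp at hxy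
  have hy : y ≠ 0 := fun h => by rw [h] at hxy; simp at hxy
  obtain ⟨k, hk, hk1, hk2⟩ := exists_int_arg_mul hx hy
  have hax := arg_nonneg_iff.2 hx'; have hay := arg_nonneg_iff.2 hy'
  have haxy := arg_neg_iff.2 hxy
  have hk0 : k = -1 := by
    rcases (show k = -1 ∨ k = 0 ∨ k = 1 by omega) with h | h | h
    · exact h
    · exfalso; rw [h] at hk; push_cast at hk; nlinarith [Real.pi_pos]
    · exfalso; rw [h] at hk; push_cast at hk; nlinarith [Real.pi_pos]
  rw [log_mul_eq_add_log_add_int hx hy k hk, hk0]; push_cast; ring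

/-- `Log(xy) = Log x + Log y − 2πi` if `x, y` are negative reals. [folklore] -/
theorem log_mul_of_neg_real_of_neg_real {x y : ℂ} (hx' : x.re < 0) (hx'' : x.im = 0)
    (hy' : y.re < 0) (hy'' : y.im = 0) : log (x * y) = log x + log y - 2 * π * I := by
  have hx : x ≠ 0 := fun h => by rw [h] at hx'; simp at hx'
  have hy : y ≠ 0 := fun h => by rw [h] at hy'; simp at hy'
  obtain ⟨k, hk, hk1, hk2⟩ := exists_int_arg_mul hx hy
  have hax := arg_eq_pi_iff.2 ⟨hx', hx''⟩; have hay := arg_eq_pi_iff.2 ⟨hy', hy''⟩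
  have hxy : arg (x * y) = 0 := arg_eq_zero_iff.2 ⟨by rw [mul_re, hx'', hy'']; nlinarith,
    by rw [mul_im, hx'', hy'']; ring⟩
  have hk0 : k = -1 := by
    rcases (show k = -1 ∨ k = 0 ∨ k = 1 by omega) with h | h | h
    · exact h
    · exfalso; rw [h, hax, hay, hxy] at hk; push_cast at hk; nlinarith [Real.pi_pos]
    · exfalso; rw [h, hax, hay, hxy] at hk; push_cast at hk; nlinarith [Real.pi_pos]
  rw [log_mul_eq_add_log_add_int hx hy k hk, hk0]; push_cast; ring

/-- `Log(xy) = Log x + Log y + 2πi` if `im x, im y < 0` and `im(xy) ≥ 0`. [folklore] -/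
theorem log_mul_of_im_neg_of_im_nonneg' {x y : ℂ} (hx' : x.im < 0) (hy' : y.im < 0)
    (hxy : 0 ≤ (x * y).im) : log (x * y) = log x + log y + 2 * π * I := by
  have hx : x ≠ 0 := fun h => by rw [h] at hx'; simp at hx'
  have hy : y ≠ 0 := fun h => by rw [h] at hy'; simp at hy'
  obtain ⟨k, hk, hk1, hk2⟩ := exists_int_arg_mul hx hy
  have hax := arg_neg_iff.2 hx'; have hay := arg_neg_iff.2 hy'
  have haxy := arg_nonneg_iff.2 hxy
  have hk0 : k = 1 := by
    rcases (show k = -1 ∨ k = 0 ∨ k = 1 by omega) with h | h | h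
    · exfalso; rw [h] at hk; push_cast at hk; nlinarith [Real.pi_pos]
    · exfalso; rw [h] at hk; push_cast at hk; nlinarith [Real.pi_pos]
    · exact h
  rw [log_mul_eq_add_log_add_int hx hy k hk, hk0]; push_cast; ring

/-- `Log` of a positive real (as a complex number with zero imaginary part). [folklore] -/
theorem log_of_pos_real {x : ℂ} (hx' : 0 < x.re) (hx'' : x.im = 0) : log x = Real.log x.re := by
  have e : x = (x.re : ℂ) := Complex.ext (by simp) (by simp [hx''])
  rw [e, ← ofReal_log hx'.le]; simp

/-- **Real multiplicative relations give additive relations of principal logarithms**: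
if `xⱼ > 0` and `∏ xⱼ^{pⱼ} = ∏ xⱼ^{nⱼ}` then `Σ (pⱼ − nⱼ) Log xⱼ = 0` (entries with `pⱼ = nⱼ` may
carry any `Mⱼ`, e.g. `2πi`). [folklore] -/
theorem sum_sub_mul_eq_zero_of_prod_pow_eq {m : ℕ} (M : Fin m → ℂ) (x : Fin m → ℝ)
    (kp kn : Fin m → ℕ) (hx : ∀ j, 0 < x j) (hM : ∀ j, kp j ≠ kn j → M j = log ((x j : ℝ) : ℂ))
    (h : ∏ j, x j ^ kp j = ∏ j, x j ^ kn j) :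
    ∑ j, ((kp j : ℂ) - (kn j : ℂ)) * M j = 0 := by
  have hlog := congrArg Real.log h
  rw [Real.log_prod (fun j _ => pow_ne_zero _ (hx j).ne'),
    Real.log_prod (fun j _ => pow_ne_zero _ (hx j).ne')] at hlog
  simp only [Real.log_pow] at hlog
  have hj : ∀ j, ((kp j : ℂ) - (kn j : ℂ)) * M j =
      (((kp j : ℝ) * Real.log (x j) - (kn j : ℝ) * Real.log (x j) : ℝ) : ℂ) := by
    intro j
    by_cases hjk : kp j = kn j
    · rw [hjk]; simp
    · rw [hM j hjk, ← ofReal_log (hx j).le]; push_cast; ring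
  rw [Finset.sum_congr rfl fun j _ => hj j, ← ofReal_sum, Finset.sum_sub_distrib, hlog, sub_self,
    ofReal_zero]

/-- `a − b√d > 0` from `b²d < a²`, `a > 0`. [folklore] -/
theorem sub_mul_sqrt_pos {a b d : ℝ} (hd : 0 ≤ d) (ha : 0 < a) (h : b ^ 2 * d < a ^ 2) :
    0 < a - b * Real.sqrt d := by
  have hs : Real.sqrt d ^ 2 = d := Real.sq_sqrt hd
  have hs0 : 0 ≤ Real.sqrt d := Real.sqrt_nonneg d
  by_cases hb : b ≤ 0
  · nlinarith
  · push Not at hb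
    have h2 : (b * Real.sqrt d) ^ 2 < a ^ 2 := by nlinarith
    have : b * Real.sqrt d < a := (abs_lt_of_sq_lt_sq' h2 ha.le).2
    linarith

/-- `a + b√d > 0` from `b²d < a²`, `a > 0`. [folklore] -/
theorem add_mul_sqrt_pos {a b d : ℝ} (hd : 0 ≤ d) (ha : 0 < a) (h : b ^ 2 * d < a ^ 2) :
    0 < a + b * Real.sqrt d := by
  have := sub_mul_sqrt_pos hd ha (show (-b) ^ 2 * d < a ^ 2 by simpa using h)
  linarith

end Logarithms

/-! ### Logarithm symbols `ℓ(M)` and lattice relations -/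

/-- `e^{Log w} = w` is algebraic for algebraic `w ≠ 0`. [folklore] -/
theorem isAlgebraic_exp_log {w : ℂ} (hw : IsAlgebraic ℚ w) (h0 : w ≠ 0) :
    IsAlgebraic ℚ (exp (log w)) := by rwa [exp_log h0]

/-- `e^{2πi} = 1` is algebraic. [folklore] -/
theorem isAlgebraic_exp_two_pi_I : IsAlgebraic ℚ (exp (2 * π * I)) := by
  rw [exp_two_pi_mul_I]; exact isAlgebraic_one

/-- **A lattice relation `Σ qⱼ Mⱼ = 0` (`qⱼ ∈ ℚ`) among generators with `e^{Mⱼ} ∈ ℚ̄` is a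
relation `Σ qⱼ ℓ(Mⱼ) ∼ 0` of logarithm symbols** (`ℚ`-linearity of `ℓ` and `ℓ(0) ∼ 0`).
[cite: HuberWustholz2022, §13.1 (A)–(B) (p. 120)] -/
theorem span_latticeRelation {m : ℕ} (M : Fin m → ℂ) (hM : ∀ j, IsAlgebraic ℚ (exp (M j)))
    (E : Fin m → CurvePath 𝔾m)
    (hE : ∀ j t, (E j).toFun t = ![exp ((1 - t) * 0 + t * M j), exp (-((1 - t) * 0 + t * M j))])
    (q : Fin m → ℚ) (hnum : ∑ j, (q j : ℂ) * M j = 0) :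
    InSpanRel (∑ j, (q j : ℂ) • Finsupp.single (logSym (E j)) (1 : ℂ)) := by
  obtain ⟨E0, hE0⟩ := exists_expPath (L₀ := 0) (L₁ := ∑ j ∈ Finset.univ, (q j : ℂ) * M j)
    isAlgebraic_exp_zero (isAlgebraic_exp_sum_rat_mul Finset.univ M hM q)
  have h₁ := span_logSym_sum Finset.univ M hM q E hE E0 hE0
  have hE0' : ∀ t, E0.toFun t = ![exp ((1 - t) * 0 + t * 0), exp (-((1 - t) * 0 + t * 0))] := by
    intro t; rw [hE0, hnum]
  have h₂ := rel_logSym_zero E0 hE0'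
  obtain ⟨k, ρ, c, hρ, hc, hsum⟩ := span_sub (span_of_rel h₂) h₁
  exact ⟨k, ρ, c, hρ, hc, by rw [← hsum, sub_sub_cancel]⟩

/-- A lattice relation with integer coefficient vector. [folklore] -/
theorem span_latticeRelation_int {m : ℕ} (M : Fin m → ℂ) (hM : ∀ j, IsAlgebraic ℚ (exp (M j)))
    (E : Fin m → CurvePath 𝔾m)
    (hE : ∀ j t, (E j).toFun t = ![exp ((1 - t) * 0 + t * M j), exp (-((1 - t) * 0 + t * M j))])
    (k : Fin m → ℤ) (hnum : ∑ j, (k j : ℂ) * M j = 0) :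
    InSpanRel (∑ j, (k j : ℂ) • Finsupp.single (logSym (E j)) (1 : ℂ)) := by
  have h := span_latticeRelation M hM E hE (fun j => (k j : ℚ)) (by exact_mod_cast hnum)
  simpa using h

/-- **Real case**: the multiplicative certificate `∏ xⱼ^{pⱼ} = ∏ xⱼ^{nⱼ}` (`xⱼ > 0`) gives the
symbol relation `Σ (pⱼ − nⱼ) ℓ(Log xⱼ) ∼ 0`. [folklore] -/
theorem span_latticeRelation_real {m : ℕ} (M : Fin m → ℂ) (hM : ∀ j, IsAlgebraic ℚ (exp (M j)))
    (E : Fin m → CurvePath 𝔾m)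
    (hE : ∀ j t, (E j).toFun t = ![exp ((1 - t) * 0 + t * M j), exp (-((1 - t) * 0 + t * M j))])
    (x : Fin m → ℝ) (kp kn : Fin m → ℕ) (hx : ∀ j, 0 < x j)
    (hMx : ∀ j, kp j ≠ kn j → M j = log ((x j : ℝ) : ℂ)) (h : ∏ j, x j ^ kp j = ∏ j, x j ^ kn j) :
    InSpanRel (∑ j, ((kp j : ℂ) - (kn j : ℂ)) • Finsupp.single (logSym (E j)) (1 : ℂ)) := by
  have hnum := sum_sub_mul_eq_zero_of_prod_pow_eq M x kp kn hx hMx h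
  have h' := span_latticeRelation_int M hM E hE (fun j => (kp j : ℤ) - kn j) (by push_cast; exact hnum)
  simpa using h'

end Summit.KontsevichZagierPeriods.KzOnePeriods.G0Derivation

end
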